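import Summits.PneNP.PneNP.Theorems.ChebyshevTracialDesignTiltedSmallBlockAverage
import Summits.PneNP.PneNP.Theorems.ChebyshevTracialDesignColourSymmetricAmplitudeOne
import HarnessLib

/-!
# Cell pnp-psdrank, route `ChebyshevTracialDesign`: THE 𝒜₁ RUNG FOR ONE-BLOCK MASKS ON SMALL BLOCKS (brick 154; crux
# `TracialDecayExp20`, stmt-PneNP-19878)

Brick 154 (prover g30; MEMO-33 §4). Brick 146/146c/146d (prover g29) gave the 𝒜₁ rung — the crux-currency value bound
`Σ_{U,M} W(U,M)·ψ(|U∩H|)·tr(B_UB_UᵀY_M) ≤ poly(n)·G·(decay)·r` for degree-one Gram contractions `B` and ANY psd contraction field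
`Y`, every dimension `r` — for BALANCED blocks `2|H| = n` (asymptotic constants); brick 150b reduced the 𝒜₁ rung of any
colour-symmetric mask class to the `M`-summed containment bound over COLOUR-TYPE-CONSTANT direction fields. This file feeds brick
153's EFFECTIVE type-constant bound for SMALL blocks (`|H| ≲ √n/3`) into brick 150b (colouring `𝟙_{H̄}`):

* §1 `card_map_inter_eq` (one-block masks are invariant under block-preserving relabelings), `dq_facts` (`4 ≤ dq n`, `dq n/2 ≤ Tq n+1`
  for `n ≥ 256`).
* §3 **`smallBlock_amplitudeOne_value_le_of_sqrt`** — the TURNKEY form: the same for EVERY block with `4|H| ≤ ⌊√n⌋` (the admissible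
  `R = s₀ − (3(dq n+1) + |H| + (Tq n−1)/2 + 2)` and `9|H|(|H|+1) ≤ n−2|H|+1` are supplied by `sqrt_block_admissible` for `⌊√n⌋ ≥ 324`).
* §2 **`smallBlock_amplitudeOne_value_le`**: ∃ `a > 0`, `n₀` such that for all even `n ≥ n₀`, every balanced `B = 20` Chebyshev
  design `(t, C, w)` (`t = 2s₀+1`), every block `|H| = h` with `9h(h+1) ≤ n−2h+1` and an `R ≥ 1` with
  `R + 3(dq n+1) + h + (Tq n−1)/2 ≤ s₀`, `R + 3(dq n+1) + h + s₀ + (Tq n−1)/2 + 2 ≤ n/2`, `(h/R)²e^{3h/R} ≤ 2`,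
  `((Tq n−1)/2)·¼(h/R)²e^{3h/R} ≤ 1/9`, every mask `0 ≤ ψ ≤ G` on `[0,t]`, every degree-one Gram contraction `B_U = Σ_p x_p(U)β_p`
  (`B_UB_Uᵀ ⪯ I` on `t`-cuts), every `0 ⪯ Y_M ⪯ I` of dimension `r`:
  `Σ_{U,M} W(U,M)·ψ(|U∩H|)·tr(B_UB_UᵀY_M) ≤ 8·(20G((5t+5Tq n+4)² + (h+1)n²)(1/3)^{⌊dq n/2⌋−1} + 160Gn⁶e^{−a·dq n} + 60Gn⁴√P_{dq n−4})·r`.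
READING (MEMO-33 §4): the small-block companion of brick 146 — the 𝒜₁ rung for one-block masks `ψ(|U∩H|)`, `|H| ≲ √n/3` (`R ≈ n/8`
works for all large `n`), ALL matching-dependent directions (through 150b: type-constant part = brick 153, effective; the `r = 1` excess and
the linear-to-containment reduction = bricks 148/150, asymptotic in `a`). Together with brick 146 (`2|H| = n`) and brick 149 (mixtures),
the one-block 𝒜₁ rung is now in the tree at both ends of the block-size range; `√n ≲ |H| < n/2`, `|H| ≠ n/2` remains (brick 153's
cut-off `a₁ > 0` covers `|H| ≲ √(nD)` for the type-constant part; unbalanced large blocks need 126/143/144 with `a ≠ d`).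
WHAT THIS FILE DOES NOT DO: masks of several blocks, products, spread masks; anything on `TracialDecayExp20` itself, psd rank of
P_PM(K_n), or P vs NP. [cite: Rothvoss2017, §2 (PDF pp. 5–6)] [cite: GriblingDelaatLaurent2019, §5]
Stature: support/instrument — a rung-type statement for a named non-junta strategy class of unbounded dimension; crux OPEN; the
decay `(1/3)^{dq n/2}·poly(n) + e^{−a dq n}·poly(n)` is ASYMPTOTIC in `a` (the `r = 1` rung); nothing on psd rank beyond the rungs.
-/

set_option linter.dupNamespace false -- `Summit.PneNP.PneNP.…`: summit = sub-problem (D-0017)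

noncomputable section

namespace Summit.PneNP.PneNP.Theorems.ChebyshevTracialDesignTiltedSmallBlockAmplitudeOne

open Finset Matrix Literature.Barriers.PneNP Literature.Combinatorics.Optimization
open Summit.PneNP.PneNP.Theorems.ChebyshevTracialDesignColourSymmetricAmplitudeOne (colourSymmetric_amplitudeOne_of_typeConstant)
open Summit.PneNP.PneNP.Theorems.ChebyshevTracialDesignTiltedSmallBlockAverage (tilted_designValue_avg_le_three_pow)

variable {n : ℕ}

/-! ### §1 Small lemmas -/

/-- A one-block mask is invariant under the vertex permutations preserving the block. [cite: Rothvoss2017, §2 (PDF p. 5)] -/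
theorem card_map_inter_eq (H U : Finset (Fin n)) (g : Equiv.Perm (Fin n)) (hg : ∀ i, g i ∈ H ↔ i ∈ H) :
    ((U.map g.toEmbedding) ∩ H).card = (U ∩ H).card := by
  have e : U.map g.toEmbedding ∩ H = (U ∩ H).map g.toEmbedding := by
    ext x
    simp only [mem_inter, mem_map, Equiv.toEmbedding_apply]
    constructor
    · rintro ⟨⟨u, hu, rfl⟩, hx⟩
      exact ⟨u, ⟨hu, (hg u).1 hx⟩, rfl⟩
    · rintro ⟨u, ⟨hu, huH⟩, rfl⟩
      exact ⟨⟨u, hu, rfl⟩, (hg u).2 huH⟩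
  rw [e, card_map]

/-- `4 ≤ dq n` once `256 ≤ n`, and `dq n / 2 ≤ Tq n + 1`. [cite: CoppersmithRivlin1992, Thm. (p. 970)] -/
theorem dq_facts (hn : 256 ≤ n) : 4 ≤ dq n ∧ dq n / 2 ≤ Tq n + 1 := by
  constructor
  · rw [dq, Nat.le_sqrt, Nat.le_sqrt]; omega
  · rw [dq, Tq]
    have h1 : Nat.sqrt (Nat.sqrt n) ≤ Nat.sqrt n := Nat.sqrt_le_self _
    omega

/-! ### §2 The 𝒜₁ rung for one-block masks on small blocks -/

/-- **THE 𝒜₁ RUNG FOR ONE-BLOCK MASKS ON SMALL BLOCKS (brick 154).** There are `a > 0` and `n₀` such that for all even `n ≥ n₀`, every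
balanced `B = 20` Chebyshev design `(t, C, w)`, every block `H` with `|H| = h`, `9h(h+1) ≤ n − 2h + 1`, and an integer `R ≥ 1` with
`R + 3(dq n+1) + h + (Tq n−1)/2 ≤ s₀` (`t = 2s₀+1`), `R + 3(dq n+1) + h + s₀ + (Tq n−1)/2 + 2 ≤ n/2`, `(h/R)²e^{3h/R} ≤ 2`,
`((Tq n−1)/2)·¼(h/R)²e^{3h/R} ≤ 1/9`, every mask `0 ≤ ψ ≤ G` on `[0,t]`, every degree-one Gram contraction `B_U = Σ_p x_p(U)β_p`
(`B_UB_Uᵀ ⪯ I` on the `t`-cuts) and every psd contraction field `0 ⪯ Y_M ⪯ I` of dimension `r`: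
`Σ_{U,M} W(U,M)·ψ(|U∩H|)·tr(B_UB_UᵀY_M) ≤ 8·(20G((5t+5Tq n+4)² + (h+1)n²)(1/3)^{⌊dq n/2⌋−1} + 160Gn⁶e^{−a·dq n} + 60Gn⁴√P_{dq n−4})·r`.
Proof: brick 150b `colourSymmetric_amplitudeOne_of_typeConstant` with the colouring `𝟙_{H̄}` and `Btc` := brick 153
`tilted_designValue_avg_le_three_pow`. [cite: Rothvoss2017, §2 (PDF pp. 5–6)] [cite: GriblingDelaatLaurent2019, §5] -/
theorem smallBlock_amplitudeOne_value_le :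
    ∃ a : ℝ, 0 < a ∧ ∃ n₀ : ℕ, ∀ n : ℕ, n₀ ≤ n → Even n → ∀ {t : ℕ} {C : Finset ℕ} {w : ℕ → ℝ},
    IsBalancedDesign n t (Tq n) (dq n) 20 C w →
    ∀ (H : Finset (Fin n)) {h s₀ R : ℕ}, H.card = h → 9 * (h * (h + 1)) ≤ n - 2 * h + 1 → t = 2 * s₀ + 1 → 1 ≤ R →
      R + 3 * (dq n + 1) + h + (Tq n - 1) / 2 ≤ s₀ → R + 3 * (dq n + 1) + h + s₀ + (Tq n - 1) / 2 + 2 ≤ n / 2 →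
      ((h : ℝ) / R) ^ 2 * Real.exp (3 * h / R) ≤ 2 →
      ((((Tq n - 1) / 2 : ℕ)) : ℝ) * ((1 / 4 : ℝ) * ((h : ℝ) / R) ^ 2 * Real.exp (3 * h / R)) ≤ 1 / 9 →
    ∀ (ψ : ℤ → ℝ) {G : ℝ}, 0 ≤ G → (∀ x ∈ Icc (0 : ℤ) (t : ℤ), |ψ x| ≤ G) → (∀ x ∈ Icc (0 : ℤ) (t : ℤ), 0 ≤ ψ x) →
    ∀ {r m : ℕ} (β : Fin n → Matrix (Fin r) (Fin m) ℝ),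
    (∀ U : OddSet n, U.1.card = t →
      (1 - (∑ p, (if p ∈ U.1 then (1 : ℝ) else 0) • β p) * (∑ p, (if p ∈ U.1 then (1 : ℝ) else 0) • β p)ᵀ).PosSemidef) →
    ∀ (Y : PMatch n → Matrix (Fin r) (Fin r) ℝ), (∀ M, (Y M).PosSemidef ∧ (1 - Y M).PosSemidef) →
    ∑ U : OddSet n, ∑ M : PMatch n, levelWeight n t C w U M *
        (ψ ((U.1 ∩ H).card : ℤ) *
          ((∑ p, (if p ∈ U.1 then (1 : ℝ) else 0) • β p) * (∑ p, (if p ∈ U.1 then (1 : ℝ) else 0) • β p)ᵀ * Y M).trace) ≤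
      8 * (20 * G * ((5 * (t : ℝ) + 5 * (Tq n) + 4) ^ 2 + ((h : ℝ) + 1) * (n : ℝ) ^ 2) * (1 / 3 : ℝ) ^ (dq n / 2 - 1) +
        160 * G * (n : ℝ) ^ 6 * Real.exp (-(a * dq n)) +
        60 * G * (n : ℝ) ^ 4 * Real.sqrt (∏ i ∈ range ((dq n - 4) / 2 + 1), ((2 * i + 1 : ℝ) / ((n : ℝ) - 2 * i)))) * r := by
  classical
  obtain ⟨a, ha, n₀, h150⟩ := colourSymmetric_amplitudeOne_of_typeConstant
  refine ⟨a, ha, max n₀ 256, ?_⟩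
  intro n hn heven t C w hbal H h s₀ R hh h9 ht hR hR1 hR2 hq hθ ψ G hG0 hG hψ0 r m β hβ Y hY
  have hn₀ : n₀ ≤ n := le_trans (le_max_left _ _) hn
  have h256 : 256 ≤ n := le_trans (le_max_right _ _) hn
  obtain ⟨hD4, hDT⟩ := dq_facts h256
  have hdes : IsExactDesign n t (Tq n) (dq n) 20 C w := hbal.1
  have hN : (univ : Finset (Fin n)).card = 2 * (n / 2) := by
    rw [card_univ, Fintype.card_fin]; obtain ⟨k, hk⟩ := heven; omega
  have hht : h ≤ t := by omega
  have h2h : 2 * h ≤ n := by omega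
  -- the colouring and the mask
  set col : Fin n → Fin 2 := fun p => if p ∈ H then 0 else 1 with hcol
  have hc0 : ∀ p, p ∈ H → col p = 0 := fun p hp => by rw [hcol]; simp [hp]
  have hc1 : ∀ p, p ∉ H → col p = 1 := fun p hp => by rw [hcol]; simp [hp]
  have hcolH : ∀ p, col p = 0 ↔ p ∈ H := fun p => by
    by_cases hp : p ∈ H
    · simp [hc0 p hp, hp]
    · simp [hc1 p hp, hp]
  set f : Finset (Fin n) → ℝ := fun U => ψ ((U ∩ H).card : ℤ) with hf
  have hUH : ∀ U : Finset (Fin n), ((U ∩ H).card : ℤ) ∈ Icc (0 : ℤ) (t : ℤ) := by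
    intro U
    rw [mem_Icc]; refine ⟨by positivity, ?_⟩
    have := card_le_card (inter_subset_right (s₁ := U) (s₂ := H))
    rw [hh] at this; exact_mod_cast this.trans hht
  have hf0 : ∀ U, 0 ≤ f U := fun U => hψ0 _ (hUH U)
  have hfG : ∀ U, f U ≤ G := fun U => (le_abs_self _).trans (hG _ (hUH U))
  have hfinv : ∀ (M : PMatch n) (g : Equiv.Perm (Fin n)), (∀ i, g (M.2.partner i) = M.2.partner (g i)) →
      (∀ i, col (g i) = col i) → ∀ U : Finset (Fin n), f (U.map g.toEmbedding) = f U := by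
    intro M g _ hg U
    rw [hf]
    simp only
    rw [card_map_inter_eq H U g (fun i => by rw [← hcolH, ← hcolH, hg i])]
  -- the type-constant bound from brick 153
  have hBtc : ∀ v : PMatch n → Fin n → ℝ, (∀ M p, |v M p| ≤ 1) →
      (∀ M p p', s(col p, col (M.2.partner p)) = s(col p', col (M.2.partner p')) → v M p = v M p') →
      ∑ M : PMatch n, ∑ U : OddSet n, levelWeight n t C w U M * (f U.1 *
        (∑ p : Fin n, v M p * ((if p ∈ U.1 then (1 : ℝ) else 0) * (if M.2.partner p ∈ U.1 then (1 : ℝ) else 0))) ^ 2) ≤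
      20 * G * ((5 * (t : ℝ) + 5 * (Tq n) + 4) ^ 2 + ((h : ℝ) + 1) * (n : ℝ) ^ 2) * (1 / 3 : ℝ) ^ (dq n / 2 - 1) := by
    intro v hv hvt
    have hvA : ∀ (M : PMatch n) p p', p ∈ H → M.2.partner p ∈ H → p' ∈ H → M.2.partner p' ∈ H → v M p = v M p' := by
      intro M p p' h1 h2 h3 h4
      exact hvt M p p' (by rw [hc0 _ h1, hc0 _ h2, hc0 _ h3, hc0 _ h4])
    have hvB : ∀ (M : PMatch n) p p', ((p ∈ H ∧ M.2.partner p ∉ H) ∨ (p ∉ H ∧ M.2.partner p ∈ H)) →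
        ((p' ∈ H ∧ M.2.partner p' ∉ H) ∨ (p' ∉ H ∧ M.2.partner p' ∈ H)) → v M p = v M p' := by
      intro M p p' hp hp'
      refine hvt M p p' ?_
      have e : ∀ q, ((q ∈ H ∧ M.2.partner q ∉ H) ∨ (q ∉ H ∧ M.2.partner q ∈ H)) →
          s(col q, col (M.2.partner q)) = s((0 : Fin 2), (1 : Fin 2)) := by
        intro q hq
        rcases hq with ⟨h1, h2⟩ | ⟨h1, h2⟩
        · rw [hc0 _ h1, hc1 _ h2]
        · rw [hc1 _ h1, hc0 _ h2, Sym2.eq_swap]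
      rw [e p hp, e p' hp']
    have hvD : ∀ (M : PMatch n) p p', p ∉ H → M.2.partner p ∉ H → p' ∉ H → M.2.partner p' ∉ H → v M p = v M p' := by
      intro M p p' h1 h2 h3 h4
      exact hvt M p p' (by rw [hc1 _ h1, hc1 _ h2, hc1 _ h3, hc1 _ h4])
    have h153 := tilted_designValue_avg_le_three_pow hdes hN H hh h9 h2h ht hD4 hDT hR hR1 hR2 hq hθ ψ hG0 hG hψ0 v hv
      hvA hvB hvD
    simpa only [hf] using h153
  have h := h150 n hn₀ heven hbal col f hG0 hf0 hfG hfinv hBtc β hβ Y hY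
  simpa only [hf] using h

/-! ### §3 The turnkey form: every block of size at most `√n/4` -/

/-- **Admissible parameters for blocks of size `≤ √n/4`.** For a balanced exact design (`t = 2s₀+1`, `n ≤ 4t`, `2t+2 ≤ n`) at the
Chebyshev parameters and `4h ≤ ⌊√n⌋`, `324 ≤ ⌊√n⌋`, the choice `R = s₀ − (3(dq n+1) + h + (Tq n−1)/2 + 2)` satisfies the four
`R`-conditions of brick 154 and `9h(h+1) ≤ n − 2h + 1`. [cite: CoppersmithRivlin1992, Thm. (p. 970)] -/
theorem sqrt_block_admissible {t s₀ h : ℕ} (ht : t = 2 * s₀ + 1) (hn4 : n ≤ 4 * t) (h2t : 2 * t + 2 ≤ n)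
    (hh4 : 4 * h ≤ Nat.sqrt n) (hm : 324 ≤ Nat.sqrt n) :
    9 * (h * (h + 1)) ≤ n - 2 * h + 1 ∧
    1 ≤ s₀ - (3 * (dq n + 1) + h + (Tq n - 1) / 2 + 2) ∧
    s₀ - (3 * (dq n + 1) + h + (Tq n - 1) / 2 + 2) + 3 * (dq n + 1) + h + (Tq n - 1) / 2 ≤ s₀ ∧
    s₀ - (3 * (dq n + 1) + h + (Tq n - 1) / 2 + 2) + 3 * (dq n + 1) + h + s₀ + (Tq n - 1) / 2 + 2 ≤ n / 2 ∧
    ((h : ℝ) / ((s₀ - (3 * (dq n + 1) + h + (Tq n - 1) / 2 + 2) : ℕ) : ℝ)) ^ 2 *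
        Real.exp (3 * h / ((s₀ - (3 * (dq n + 1) + h + (Tq n - 1) / 2 + 2) : ℕ) : ℝ)) ≤ 2 ∧
    ((((Tq n - 1) / 2 : ℕ)) : ℝ) * ((1 / 4 : ℝ) * ((h : ℝ) / ((s₀ - (3 * (dq n + 1) + h + (Tq n - 1) / 2 + 2) : ℕ) : ℝ)) ^ 2 *
        Real.exp (3 * h / ((s₀ - (3 * (dq n + 1) + h + (Tq n - 1) / 2 + 2) : ℕ) : ℝ))) ≤ 1 / 9 := by
  set m := Nat.sqrt n with hmdef
  have hmn : m * m ≤ n := Nat.sqrt_le n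
  have hdq : dq n ≤ m := by rw [dq]; exact Nat.sqrt_le_self _
  have hT : (Tq n - 1) / 2 = 2 * m + 1 := by rw [Tq]; omega
  have hm324 : 324 * m ≤ m * m := Nat.mul_le_mul_right m hm
  set K := 3 * (dq n + 1) + h + (Tq n - 1) / 2 + 2 with hKdef
  have hK : K ≤ 6 * m + 6 := by rw [hKdef, hT]; omega
  have hs₀ : m * m ≤ 8 * s₀ + 4 := by omega
  set R := s₀ - K with hRdef
  have hR16 : m * m ≤ 16 * R := by omega
  have hR1 : 1 ≤ R := by nlinarith
  -- `3h ≤ R` and `h·m ≤ 4R`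
  have hhm : h * m ≤ 4 * R := by nlinarith
  have h3h : 3 * h ≤ R := by nlinarith
  have h16 : 16 * (h * h) ≤ m * m := by nlinarith
  have h9 : 9 * (h * (h + 1)) + 2 * h ≤ m * m := by nlinarith
  refine ⟨by omega, hR1, by omega, by omega, ?_, ?_⟩
  all_goals
    have hRr : (1 : ℝ) ≤ R := by exact_mod_cast hR1
    have hRpos : (0 : ℝ) < R := by linarith
    have hmr : (324 : ℝ) ≤ m := by exact_mod_cast hm
    have hmpos : (0 : ℝ) < m := by linarith
    have hhm' : (h : ℝ) * m ≤ 4 * R := by exact_mod_cast hhm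
    have h3h' : 3 * (h : ℝ) ≤ R := by exact_mod_cast h3h
    have hexp : Real.exp (3 * (h : ℝ) / R) ≤ 3 := by
      have h1 : 3 * (h : ℝ) / R ≤ 1 := by rw [div_le_one hRpos]; exact h3h'
      exact (Real.exp_le_exp.2 h1).trans (Real.exp_one_lt_d9.le.trans (by norm_num))
    have hq : ((h : ℝ) / R) ^ 2 ≤ 16 / (m : ℝ) ^ 2 := by
      have h1 : (h : ℝ) / R ≤ 4 / m := by
        rw [div_le_div_iff₀ hRpos hmpos]; linarith
      have h0 : 0 ≤ (h : ℝ) / R := by positivity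
      calc ((h : ℝ) / R) ^ 2 ≤ (4 / (m : ℝ)) ^ 2 := pow_le_pow_left₀ h0 h1 2
        _ = 16 / (m : ℝ) ^ 2 := by rw [div_pow]; norm_num
    have hqe : ((h : ℝ) / R) ^ 2 * Real.exp (3 * (h : ℝ) / R) ≤ 48 / (m : ℝ) ^ 2 :=
      calc _ ≤ 16 / (m : ℝ) ^ 2 * 3 := mul_le_mul hq hexp (Real.exp_nonneg _) (by positivity)
        _ = 48 / (m : ℝ) ^ 2 := by ring
  · calc _ ≤ 48 / (m : ℝ) ^ 2 := hqe
      _ ≤ 2 := by rw [div_le_iff₀ (by positivity)]; nlinarith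
  · rw [hT]
    push_cast
    calc (2 * (m : ℝ) + 1) * (1 / 4 * ((h : ℝ) / R) ^ 2 * Real.exp (3 * (h : ℝ) / R))
        = (2 * (m : ℝ) + 1) * (1 / 4 * (((h : ℝ) / R) ^ 2 * Real.exp (3 * (h : ℝ) / R))) := by ring
      _ ≤ (2 * (m : ℝ) + 1) * (1 / 4 * (48 / (m : ℝ) ^ 2)) :=
          mul_le_mul_of_nonneg_left (mul_le_mul_of_nonneg_left hqe (by norm_num)) (by positivity)
      _ = 12 * (2 * (m : ℝ) + 1) / (m : ℝ) ^ 2 := by ring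
      _ ≤ 1 / 9 := by rw [div_le_iff₀ (by positivity)]; nlinarith

/-- **THE 𝒜₁ RUNG FOR ONE-BLOCK MASKS ON BLOCKS OF SIZE `≤ √n/4` (turnkey form of brick 154).** There are `a > 0` and `n₀` such that for
all even `n ≥ n₀`, every balanced `B = 20` Chebyshev design `(t, C, w)`, every block `H` with `4|H| ≤ ⌊√n⌋`, every mask `0 ≤ ψ ≤ G` on
`[0,t]`, every degree-one Gram contraction `B_U = Σ_p x_p(U)β_p` with `B_UB_Uᵀ ⪯ I` on the `t`-cuts and every psd contraction field
`0 ⪯ Y_M ⪯ I` of dimension `r`: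
`Σ_{U,M} W(U,M)·ψ(|U∩H|)·tr(B_UB_UᵀY_M) ≤ 8·(20G((5t+5Tq n+4)² + (|H|+1)n²)(1/3)^{⌊dq n/2⌋−1} + 160Gn⁶e^{−a·dq n} + 60Gn⁴√P_{dq n−4})·r`.
[cite: Rothvoss2017, §2 (PDF pp. 5–6)] [cite: GriblingDelaatLaurent2019, §5] -/
theorem smallBlock_amplitudeOne_value_le_of_sqrt :
    ∃ a : ℝ, 0 < a ∧ ∃ n₀ : ℕ, ∀ n : ℕ, n₀ ≤ n → Even n → ∀ {t : ℕ} {C : Finset ℕ} {w : ℕ → ℝ},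
    IsBalancedDesign n t (Tq n) (dq n) 20 C w →
    ∀ (H : Finset (Fin n)), 4 * H.card ≤ Nat.sqrt n →
    ∀ (ψ : ℤ → ℝ) {G : ℝ}, 0 ≤ G → (∀ x ∈ Icc (0 : ℤ) (t : ℤ), |ψ x| ≤ G) → (∀ x ∈ Icc (0 : ℤ) (t : ℤ), 0 ≤ ψ x) →
    ∀ {r m : ℕ} (β : Fin n → Matrix (Fin r) (Fin m) ℝ),
    (∀ U : OddSet n, U.1.card = t →
      (1 - (∑ p, (if p ∈ U.1 then (1 : ℝ) else 0) • β p) * (∑ p, (if p ∈ U.1 then (1 : ℝ) else 0) • β p)ᵀ).PosSemidef) →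
    ∀ (Y : PMatch n → Matrix (Fin r) (Fin r) ℝ), (∀ M, (Y M).PosSemidef ∧ (1 - Y M).PosSemidef) →
    ∑ U : OddSet n, ∑ M : PMatch n, levelWeight n t C w U M *
        (ψ ((U.1 ∩ H).card : ℤ) *
          ((∑ p, (if p ∈ U.1 then (1 : ℝ) else 0) • β p) * (∑ p, (if p ∈ U.1 then (1 : ℝ) else 0) • β p)ᵀ * Y M).trace) ≤
      8 * (20 * G * ((5 * (t : ℝ) + 5 * (Tq n) + 4) ^ 2 + ((H.card : ℝ) + 1) * (n : ℝ) ^ 2) * (1 / 3 : ℝ) ^ (dq n / 2 - 1) +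
        160 * G * (n : ℝ) ^ 6 * Real.exp (-(a * dq n)) +
        60 * G * (n : ℝ) ^ 4 * Real.sqrt (∏ i ∈ range ((dq n - 4) / 2 + 1), ((2 * i + 1 : ℝ) / ((n : ℝ) - 2 * i)))) * r := by
  obtain ⟨a, ha, n₀, h154⟩ := smallBlock_amplitudeOne_value_le
  refine ⟨a, ha, max n₀ (324 * 324), ?_⟩
  intro n hn heven t C w hbal H hh4 ψ G hG0 hG hψ0 r m β hβ Y hY
  have hn₀ : n₀ ≤ n := le_trans (le_max_left _ _) hn
  have hm : 324 ≤ Nat.sqrt n := by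
    rw [Nat.le_sqrt]; exact le_trans (le_max_right _ _) hn
  have hn4 : n ≤ 4 * t := hbal.2
  have h2t : 2 * t + 2 ≤ n := hbal.1.2.1
  obtain ⟨s₀, hs₀⟩ := hbal.1.1
  obtain ⟨h9, hR1, hRa, hRb, hq, hθ⟩ := sqrt_block_admissible (n := n) (h := H.card) hs₀ hn4 h2t hh4 hm
  exact h154 n hn₀ heven hbal H rfl h9 hs₀ hR1 hRa hRb hq hθ ψ hG0 hG hψ0 β hβ Y hY

end Summit.PneNP.PneNP.Theorems.ChebyshevTracialDesignTiltedSmallBlockAmplitudeOne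

end
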